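import Mathlib
import Literature.Probability.LatticeModels.GKSInequalities
import HarnessLib

/-!
# Ginibre's `⟨q_a q_z t_w⟩ ≥ 0`: the lower bound `u₃(a,z,w) ≥ −2⟨σ_w⟩⟨σ_a;σ_z⟩` on the third cumulant

Helper for the crux `PrecisionLaplacian.InverseMFerromagnet` (stmt-CriticalPhenomena-4798), line `Sketch`
(lead prover-line-stmt-CriticalPhenomena-4798-0).  THEOREM-ONLY file.

In Ginibre's duplicated system (two independent copies `ω, ω'` of a spin system with nonnegative couplings,
difference variables `q_x = σ_x(ω) − σ_x(ω')` and sum variables `t_x = σ_x(ω) + σ_x(ω')`) every product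
of `q`'s and `t`'s has nonnegative expectation (Ginibre 1970; Friedli–Velenik 2017, proof of Thm. 3.49: the
change of variables `ω' = ω ω''` turns the double sum into single sums with the twisted couplings
`Kᵢ(1 + ω''_{Cᵢ}) ≥ 0`).  The instance `⟨q_a q_z t_w⟩ ≥ 0` (`ginibre_qqt_sum_nonneg`) reads, after division by
`Z²`,
  `⟨σ_aσ_zσ_w⟩ + ⟨σ_aσ_z⟩⟨σ_w⟩ − ⟨σ_aσ_w⟩⟨σ_z⟩ − ⟨σ_zσ_w⟩⟨σ_a⟩ ≥ 0`,
i.e. `u₃(a,z,w) + 2⟨σ_w⟩ Cov(σ_a,σ_z) ≥ 0` (`helper_ginibre_u3_lower`): the (negative, by GHS) third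
cumulant is bounded below by `−2 m_w Cov(a,z)`.  In the line this is inequality (U'), which together with
GHS-with-sign-flips and level two of the ladder proves the quadratic predictor law QPL on every block with at
most one site outside the pair `{a,z}` (see `Lines/Sketch.md`).  No sign hypothesis on the supports is
needed: only `K ≥ 0`.
-/

namespace Summit.CriticalPhenomena.Ising3DConformalLimit.Cruxes.InverseMFerromagnet.PartialCovarianceLadder

open Literature.Probability.LatticeModels Finset
open scoped symmDiff

noncomputable section

variable {Λ ι : Type*} [Fintype Λ] [DecidableEq Λ]

omit [Fintype Λ] [DecidableEq Λ] in
/-- `σ_x(ω ω'') = σ_x(ω) σ_x(ω'')`. [folklore] -/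
theorem ginibre_spinAt_mul (x : Λ) (ω ω'' : SpinConfig Λ) :
    spinAt x (ω * ω'') = spinAt x ω * spinAt x ω'' := by
  simp [spinAt, Units.val_mul, Int.cast_mul]

omit [Fintype Λ] in
/-- `σ_a σ_z σ_w = σ_{({a} ∆ {z}) ∆ {w}}` (repetitions allowed). [folklore] -/
theorem ginibre_triple_eq_spinProduct (a z w : Λ) (ω : SpinConfig Λ) :
    spinAt a ω * spinAt z ω * spinAt w ω = spinProduct (({a} ∆ {z}) ∆ {w}) ω := by
  have ha : spinAt a ω = spinProduct {a} ω := by simp [spinProduct]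
  have hz : spinAt z ω = spinProduct {z} ω := by simp [spinProduct]
  have hw : spinAt w ω = spinProduct {w} ω := by simp [spinProduct]
  rw [ha, hz, hw, spinProduct_mul_eq_spinProduct_symmDiff, spinProduct_mul_eq_spinProduct_symmDiff]

/-- **Ginibre's inequality `⟨q_a q_z t_w⟩ ≥ 0`, unnormalised**: for nonnegative couplings,
`∑_{ω,ω'} (σ_a(ω) − σ_a(ω'))(σ_z(ω) − σ_z(ω'))(σ_w(ω) + σ_w(ω')) e^{…(ω)} e^{…(ω')} ≥ 0`.
Proof: Ginibre's change of variables `ω' = ω ω''` (`sum_sum_mul_gksWeight_eq`) gives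
`∑_{ω''} (1 − ω''_a)(1 − ω''_z)(1 + ω''_w) · Z_{K(1+ω'')}⟨σ_aσ_zσ_w⟩_{K(1+ω'')}`, a sum of products of a
nonnegative number and a GKS-I-nonnegative sum. [folklore] -/
theorem ginibre_qqt_sum_nonneg (s : Finset ι) (K : ι → ℝ) (C : ι → Finset Λ)
    (hK : ∀ i ∈ s, 0 ≤ K i) (a z w : Λ) :
    0 ≤ ∑ ω, ∑ ω', (spinAt a ω - spinAt a ω') * (spinAt z ω - spinAt z ω') *
        (spinAt w ω + spinAt w ω') * (gksWeight s K C ω * gksWeight s K C ω') := by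
  classical
  rw [sum_sum_mul_gksWeight_eq]
  refine Finset.sum_nonneg fun ω'' _ => ?_
  have h2 : ∀ ω : SpinConfig Λ,
      (spinAt a ω - spinAt a (ω * ω'')) * (spinAt z ω - spinAt z (ω * ω'')) *
          (spinAt w ω + spinAt w (ω * ω'')) =
        ((1 - spinAt a ω'') * (1 - spinAt z ω'') * (1 + spinAt w ω'')) *
          spinProduct (({a} ∆ {z}) ∆ {w}) ω := by
    intro ω
    rw [ginibre_spinAt_mul, ginibre_spinAt_mul, ginibre_spinAt_mul,
      ← ginibre_triple_eq_spinProduct]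
    ring
  simp_rw [h2]
  rw [show (∑ ω, (1 - spinAt a ω'') * (1 - spinAt z ω'') * (1 + spinAt w ω'') *
        spinProduct (({a} ∆ {z}) ∆ {w}) ω *
        gksWeight s (fun i => K i + K i * spinProduct (C i) ω'') C ω) =
      (1 - spinAt a ω'') * (1 - spinAt z ω'') * (1 + spinAt w ω'') *
        gksSum s (fun i => K i + K i * spinProduct (C i) ω'') C (spinProduct (({a} ∆ {z}) ∆ {w})) from by
    rw [gksSum, Finset.mul_sum]
    exact Finset.sum_congr rfl fun ω _ => by ring]
  have hcoef : 0 ≤ (1 - spinAt a ω'') * (1 - spinAt z ω'') * (1 + spinAt w ω'') := by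
    have h1 : ∀ x : Λ, 0 ≤ 1 - spinAt x ω'' := fun x => by
      rcases spinAt_eq_one_or_eq_neg_one x ω'' with h | h <;> rw [h] <;> norm_num
    have h3 : 0 ≤ 1 + spinAt w ω'' := by
      rcases spinAt_eq_one_or_eq_neg_one w ω'' with h | h <;> rw [h] <;> norm_num
    exact mul_nonneg (mul_nonneg (h1 a) (h1 z)) h3
  exact mul_nonneg hcoef
    (gksSum_spinProduct_nonneg s _ C (twisted_nonneg_of_nonneg s C hK ω'') _)

/-- Expansion of the duplicated sum: `∑∑ q_aq_zt_w ww' = 2(S(σ_aσ_zσ_w)·Z + S(σ_aσ_z)S(σ_w) −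
S(σ_aσ_w)S(σ_z) − S(σ_zσ_w)S(σ_a))` with `S = gksSum`, `Z = S(1)`. [folklore] -/
theorem ginibre_qqt_sum_eq (s : Finset ι) (K : ι → ℝ) (C : ι → Finset Λ) (a z w : Λ) :
    ∑ ω, ∑ ω', (spinAt a ω - spinAt a ω') * (spinAt z ω - spinAt z ω') *
        (spinAt w ω + spinAt w ω') * (gksWeight s K C ω * gksWeight s K C ω') =
      2 * (gksSum s K C (fun ω => spinAt a ω * spinAt z ω * spinAt w ω) * gksSum s K C (fun _ => 1)
        + gksSum s K C (fun ω => spinAt a ω * spinAt z ω) * gksSum s K C (spinAt w)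
        - gksSum s K C (fun ω => spinAt a ω * spinAt w ω) * gksSum s K C (spinAt z)
        - gksSum s K C (fun ω => spinAt z ω * spinAt w ω) * gksSum s K C (spinAt a)) := by
  simp only [gksSum, Finset.sum_mul_sum, one_mul]
  have hsymm : ∀ F : SpinConfig Λ → SpinConfig Λ → ℝ,
      ∑ ω, ∑ ω', F ω ω' * (gksWeight s K C ω * gksWeight s K C ω') =
        ∑ ω, ∑ ω', F ω' ω * (gksWeight s K C ω * gksWeight s K C ω') := by
    intro F
    rw [Finset.sum_comm]
    refine Finset.sum_congr rfl fun ω _ => Finset.sum_congr rfl fun ω' _ => by ring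
  -- write the integrand as G ω ω' + G ω' ω with G collecting half of the eight monomials
  set G : SpinConfig Λ → SpinConfig Λ → ℝ := fun ω ω' =>
    spinAt a ω * spinAt z ω * spinAt w ω + spinAt a ω * spinAt z ω * spinAt w ω'
      - spinAt a ω * spinAt w ω * spinAt z ω' - spinAt z ω * spinAt w ω * spinAt a ω' with hG
  have hsplit : ∀ ω ω' : SpinConfig Λ,
      (spinAt a ω - spinAt a ω') * (spinAt z ω - spinAt z ω') * (spinAt w ω + spinAt w ω') =
        G ω ω' + G ω' ω := by
    intro ω ω'; simp only [hG]; ring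
  have hlhs : ∑ ω, ∑ ω', (spinAt a ω - spinAt a ω') * (spinAt z ω - spinAt z ω') *
        (spinAt w ω + spinAt w ω') * (gksWeight s K C ω * gksWeight s K C ω') =
      2 * ∑ ω, ∑ ω', G ω ω' * (gksWeight s K C ω * gksWeight s K C ω') := by
    simp_rw [hsplit, add_mul, Finset.sum_add_distrib]
    rw [← hsymm G, two_mul]
  rw [hlhs]
  congr 1
  simp only [hG, add_mul, sub_mul, Finset.sum_add_distrib, Finset.sum_sub_distrib]
  congr 1
  · congr 1
    · congr 1
      · refine Finset.sum_congr rfl fun ω _ => Finset.sum_congr rfl fun ω' _ => by ring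
      · refine Finset.sum_congr rfl fun ω _ => Finset.sum_congr rfl fun ω' _ => by ring
    · refine Finset.sum_congr rfl fun ω _ => Finset.sum_congr rfl fun ω' _ => by ring
  · refine Finset.sum_congr rfl fun ω _ => Finset.sum_congr rfl fun ω' _ => by ring

/-- Registered helper `helper_ginibre_u3_lower` — **(U'): `u₃(a,z,w) ≥ −2⟨σ_w⟩ Cov(σ_a,σ_z)`**, in the
normalised form `⟨σ_aσ_zσ_w⟩ + ⟨σ_aσ_z⟩⟨σ_w⟩ − ⟨σ_aσ_w⟩⟨σ_z⟩ − ⟨σ_zσ_w⟩⟨σ_a⟩ ≥ 0`, for every spin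
system on `Fin n` with nonnegative couplings (pairs, nonnegative fields, anything). [folklore] -/
theorem helper_ginibre_u3_lower :
    ∀ (n m : ℕ) (K : Fin m → ℝ) (C : Fin m → Finset (Fin n)), (∀ i, 0 ≤ K i) → ∀ a z w : Fin n,
      0 ≤ gksExpect Finset.univ K C (fun ω => spinAt a ω * spinAt z ω * spinAt w ω)
          + gksExpect Finset.univ K C (fun ω => spinAt a ω * spinAt z ω) * gksExpect Finset.univ K C (spinAt w)
          - gksExpect Finset.univ K C (fun ω => spinAt a ω * spinAt w ω) * gksExpect Finset.univ K C (spinAt z)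
          - gksExpect Finset.univ K C (fun ω => spinAt z ω * spinAt w ω) * gksExpect Finset.univ K C (spinAt a) := by
  intro n m K C hK a z w
  have hZ := gksSum_one_pos Finset.univ K C
  have h := ginibre_qqt_sum_nonneg Finset.univ K C (fun i _ => hK i) a z w
  rw [ginibre_qqt_sum_eq] at h
  have h' : 0 ≤ gksSum Finset.univ K C (fun ω => spinAt a ω * spinAt z ω * spinAt w ω) *
        gksSum Finset.univ K C (fun _ => 1)
      + gksSum Finset.univ K C (fun ω => spinAt a ω * spinAt z ω) * gksSum Finset.univ K C (spinAt w)
      - gksSum Finset.univ K C (fun ω => spinAt a ω * spinAt w ω) * gksSum Finset.univ K C (spinAt z)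
      - gksSum Finset.univ K C (fun ω => spinAt z ω * spinAt w ω) * gksSum Finset.univ K C (spinAt a) := by
    linarith
  have key : gksExpect Finset.univ K C (fun ω => spinAt a ω * spinAt z ω * spinAt w ω)
          + gksExpect Finset.univ K C (fun ω => spinAt a ω * spinAt z ω) * gksExpect Finset.univ K C (spinAt w)
          - gksExpect Finset.univ K C (fun ω => spinAt a ω * spinAt w ω) * gksExpect Finset.univ K C (spinAt z)
          - gksExpect Finset.univ K C (fun ω => spinAt z ω * spinAt w ω) * gksExpect Finset.univ K C (spinAt a)
      = (gksSum Finset.univ K C (fun ω => spinAt a ω * spinAt z ω * spinAt w ω) *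
        gksSum Finset.univ K C (fun _ => 1)
      + gksSum Finset.univ K C (fun ω => spinAt a ω * spinAt z ω) * gksSum Finset.univ K C (spinAt w)
      - gksSum Finset.univ K C (fun ω => spinAt a ω * spinAt w ω) * gksSum Finset.univ K C (spinAt z)
      - gksSum Finset.univ K C (fun ω => spinAt z ω * spinAt w ω) * gksSum Finset.univ K C (spinAt a))
        / (gksSum Finset.univ K C (fun _ => 1) * gksSum Finset.univ K C (fun _ => 1)) := by
    simp only [gksExpect]
    field_simp
  rw [key]
  exact div_nonneg h' (mul_pos hZ hZ).le

end

end Summit.CriticalPhenomena.Ising3DConformalLimit.Cruxes.InverseMFerromagnet.PartialCovarianceLadder
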